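import Summits.QuantumFields.BalabanUV.T4Continuum.Support.ShellMeasureLogConcave

/-!
# `T4Continuum.ShellMeasureLogConcaveSU2` — member (λ) over the REALIZED configuration space for `G = SU(2)`, the
# exact-convexity price as defect arithmetic, and the negative certificate «convexity cannot be weakened to smoothness»
# (cell `pub-balaban`, sub-cell `t4`, spine estimate NE7c (node U5b), lineage t4-ne7c-p1 = PROVER seat P1
# «shell-measure route», generation 24; tree target `Summits/QuantumFields/BalabanUV/T4Continuum/Support/`;
# ADDITIVE — imports `ShellMeasureLogConcave` only and modifies nothing)

HONEST FRAMING.  Finite four-torus programme, rung (B)+1 only — NOT infinite volume, NOT a mass gap, NOT the Clay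
problem, NOT summit progress; (B), `BetaPertHyp`, (B^μ) are not mentioned because nothing here consumes them.  The
cell wall of NE7c — (M1) `T4ShellMeasure.SlotAntiConcentration` FOR BAŁABAN'S INDUCTIVELY DEFINED EFFECTIVE MEASURES —
is NOT PRINTED in [Balaban 1983–89] (GAPS G-ne7cp1-1), asserted by nobody, and NOT moved by this file.  Every
declaration is [folklore] kernel mathematics, 0 sorry, 0 citations.

THE POINTS.
* §1 THE REALIZED HEADLINE FOR `G = SU(2)`.  Same data and frame as
  `ShellMeasureScalingSU2.slotAntiConcentration_realized_su2_of_coreMap` (bonds `Λ`, exponential cube chart of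
  half-side `S`, `3S² < π²`, centres `c V`, block weights `R V`, window factorisation `hFw`, per-section finiteness),
  with the deformation hypotheses (S-i) `hcore` / (S-ii) `hden` and the budget `(n + B_f)·a ≤ D·ρ` REPLACED by:
  (C-i) `hconv` — the sectioned classifier read in the chart is CONVEX on the support of the chart-side weight;
  (C-ii) `hlc` — the chart-side sectioned weight `1_{[-S,S]ⁿ}·e^{−jac_e}·(R V ∘ κ)` is LOG-CONCAVE;
  (C-iii) `hhalf` — per section, total mass `≤ e^P ×` the mass below half-threshold.  CONCLUSION: (M1) for the realized
  law `(fieldMeasure P j SU2).withDensity F` with `D = 2P` — no `n`, no `B_f`, no depth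
  (`slotAntiConcentration_realized_su2_of_logConcave`; chart identity `ShellMeasureScalingSU2.chart_su2` by name).
* §2 THE PRICE AS ARITHMETIC.  If `|u − v| ≤ η` pointwise and the convex comparison classifier `v` satisfies (M1) at
  threshold `θ + η` and relative width `(θρ + 2η)/(θ + η)`, then the shell of `u` at `(θ, ρ)` has mass
  `≤ D·(θρ + 2η)/(θ + η) × mass` (`shell_le_of_near`): the convexity defect `η` is ADDED to `θρ`, never multiplied —
  for Bałaban's verbatim classifier `η/θ ≍ C·R_j²ε_j ≫ ρ_j`, so (λ) transfers nothing to it; for the linearised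
  classifier `η = 0`.
* §3 NEGATIVE CERTIFICATE.  Under the UNIFORM law on `[−1,1]` (density `1_{[−1,1]}`, log-concave:
  `toyWeight_isLogConcave`) the ANALYTIC, non-convex classifier `u(x) = 1 − x²` has mass ratio `e^{−P} = 1/8` below
  half-threshold (`toy_halfMass`, a crude bound) and shell mass `vol{1 − ρ ≤ u < 1} = 2√ρ` (`toy_shell`); hence for
  every `D` some `ρ ∈ (0, 1/4]` violates (M1) at `θ = 1` (`not_slotAntiConcentration_concaveToy`).  So in member (λ)
  convexity of the classifier cannot be replaced by smoothness or analyticity: the critical level of a non-convex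
  classifier carries an unbounded density, whatever the log-concave law.  (Consistent with (γ_loc): the contraction
  `x ↦ e^{−a}x` INCREASES `1 − x²`, so (S-i) fails for this toy too.)

WHAT THIS DOES NOT DO.  No instance of (C-i)/(C-ii)/(C-iii) for Bałaban's sectioned block weights is constructed; the
log-concavity of the SU(2) Jacobian factor is not separated out of (C-ii) (see the companion's caveat); NE7c NOT proved.
-/

namespace Summit.QuantumFields.BalabanUV.T4Continuum.ShellMeasureLogConcaveSU2

open MeasureTheory Set Function
open scoped ENNReal
open Literature.MathematicalPhysics.QuantumFieldTheory.Balaban1983to89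
open T4ShellMeasure (SlotAntiConcentration)
open ShellMeasureLogConcave (IsLogConcaveWeight ConvexOnSupport slotAntiConcentration_of_logConcave
  isLogConcaveWeight_indicator_one)

/-! ## §1 The realized headline for `G = SU(2)`: (C-i), (C-ii), (C-iii) per frozen exterior -/

section Realized

open T4CubePoincare (cube measurableSet_cube')
open T4CubeChartGnomonic (SU2)
open T4CubeChartExp (expJac expWindowDensity measurable_expWindowDensity expFibreChart continuous_expFibreChart)
open T4ShellMeasureDet (blockLaw slotAntiConcentration_of_chart slotAntiConcentration_realized_of_sections
  measurable_section withDensity_eq_map_chart)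
open ShellMeasureScalingSU2 (chart_su2 chartLaw_univ_eq measurable_chartWeight)

variable {P : Params} {j : ℕ} [DecidableEq (PBond P j)]

/-- **MEMBER (λ) FOR `G = SU(2)`, REALIZED.**  Data: the bonds `Λ` of the slot's block with an enumeration `e` of the
`n = 3·#Λ` chart coordinates; a window half-side `S` (`0 < S`, `3S² < π²`); for every exterior `V` a chart centre `c V`
and a measurable block weight `R V`; the realized density `F` with the WINDOW FACTORISATION
`F(V[Λ := y]) = χ_{Λ,cV,S}(y)·R V y` (`hFw`); per-section finiteness; the classifier `u`; numbers `θ > 0`,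
`0 ≤ ρ ≤ 1/2`, `P ≥ 0`.  HYPOTHESES per `V`, in the chart `κ = expFibreChart Λ (c V) e`: (C-ii) `hlc` — the chart-side
weight `x ↦ 1_{[-S,S]ⁿ}(x)·e^{−jac_e(x)}·R V(κ x)` is log-concave; (C-i) `hconv` — `x ↦ u(V[Λ := κ x])` is convex on
its support; (C-iii) `hhalf` — the block section law has total mass `≤ e^P ×` its mass on `{u < θ/2}`.  CONCLUSION:
`SlotAntiConcentration ((fieldMeasure P j SU2).withDensity F) u θ ρ (2P)`. [folklore] -/
theorem slotAntiConcentration_realized_su2_of_logConcave (Λ : Finset (PBond P j)) {n : ℕ}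
    (e : ↥Λ × Fin 3 ≃ Fin n) {S : ℝ} (hS : 0 < S) (hSπ : 3 * S ^ 2 < Real.pi ^ 2)
    (c : GaugeField P j SU2 → GaugeField P j SU2)
    {R : GaugeField P j SU2 → (↥Λ → SU2) → ℝ≥0∞} (hR : ∀ V, Measurable (R V))
    {F : GaugeField P j SU2 → ℝ≥0∞} (hF : Measurable F)
    (hFw : ∀ V y, F (updateFinset V Λ y) =
      ENNReal.ofReal (expWindowDensity Λ (c V) S (updateFinset (c V) Λ y)) * R V y)
    (hfin : ∀ V, ((blockLaw Λ).withDensity fun y => F (updateFinset V Λ y)) univ ≠ ∞)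
    {u : GaugeField P j SU2 → ℝ} (hu : Measurable u) {θ ρ Pm : ℝ} (hθ : 0 < θ) (hρ0 : 0 ≤ ρ) (hρ : ρ ≤ 1 / 2)
    (hPm : 0 ≤ Pm)
    (hlc : ∀ V, IsLogConcaveWeight fun x : Fin n → ℝ =>
      (cube n S).indicator (fun x => ENNReal.ofReal (Real.exp (-expJac Λ e x))) x *
        R V (expFibreChart Λ (c V) e x))
    (hconv : ∀ V, ConvexOnSupport
      (fun x : Fin n → ℝ => (cube n S).indicator (fun x => ENNReal.ofReal (Real.exp (-expJac Λ e x))) x *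
        R V (expFibreChart Λ (c V) e x))
      (fun x => u (updateFinset V Λ (expFibreChart Λ (c V) e x))))
    (hhalf : ∀ V, ((blockLaw Λ).withDensity fun y => F (updateFinset V Λ y)) univ ≤
      ENNReal.ofReal (Real.exp Pm) *
        ((blockLaw Λ).withDensity fun y => F (updateFinset V Λ y)) {y | u (updateFinset V Λ y) < θ / 2}) :
    SlotAntiConcentration ((fieldMeasure P j SU2).withDensity F) u θ ρ (2 * Pm) := by
  refine slotAntiConcentration_realized_of_sections Λ hF hu fun V => ?_
  have hκ : Measurable (expFibreChart Λ (c V) e) := (continuous_expFibreChart e).measurable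
  have hw : Measurable fun y : ↥Λ → SU2 =>
      ENNReal.ofReal (expWindowDensity Λ (c V) S (updateFinset (c V) Λ y)) :=
    ENNReal.measurable_ofReal.comp ((measurable_expWindowDensity Λ (c V) S).comp measurable_updateFinset)
  have hsecF : (fun y => F (updateFinset V Λ y)) =
      fun y => ENNReal.ofReal (expWindowDensity Λ (c V) S (updateFinset (c V) Λ y)) * R V y := funext (hFw V)
  have huV : Measurable fun y => u (updateFinset V Λ y) := measurable_section Λ hu V
  have hfinV := hfin V
  have hhalfV := hhalf V
  rw [hsecF] at hfinV hhalfV ⊢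
  refine slotAntiConcentration_of_chart (blockLaw Λ) volume hκ (measurable_chartWeight e S) hw
    (chart_su2 Λ (c V) e hS hSπ) (hR V) huV ?_
  -- the chart identity transports the two masses of (C-iii) to the chart side
  have hident := withDensity_eq_map_chart (blockLaw Λ) volume hκ (measurable_chartWeight e S) hw
    (chart_su2 Λ (c V) e hS hSπ) (hR V)
  have hpre : ∀ s : Set (↥Λ → SU2), MeasurableSet s →
      ((volume : Measure (Fin n → ℝ)).withDensity fun x =>
          (cube n S).indicator (fun x => ENNReal.ofReal (Real.exp (-expJac Λ e x))) x *
            R V (expFibreChart Λ (c V) e x)) (expFibreChart Λ (c V) e ⁻¹' s) =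
        ((blockLaw Λ).withDensity fun y =>
          ENNReal.ofReal (expWindowDensity Λ (c V) S (updateFinset (c V) Λ y)) * R V y) s := by
    intro s hs
    rw [hident, Measure.map_apply hκ hs]
  have huniv := hpre univ MeasurableSet.univ
  rw [preimage_univ] at huniv
  have hlev := hpre {y | u (updateFinset V Λ y) < θ / 2} (measurableSet_lt huV measurable_const)
  have hwm : Measurable fun x : Fin n → ℝ =>
      (cube n S).indicator (fun x => ENNReal.ofReal (Real.exp (-expJac Λ e x))) x *
        R V (expFibreChart Λ (c V) e x) := (measurable_chartWeight e S).mul ((hR V).comp hκ)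
  refine slotAntiConcentration_of_logConcave hwm (hlc V) (by rw [huniv]; exact hfinV) (huV.comp hκ) (hconv V)
    hθ hρ0 hρ hPm ?_
  rw [huniv]
  refine hhalfV.trans (le_of_eq ?_)
  rw [← hlev]
  rfl

end Realized

/-! ## §2 The price as arithmetic: a convexity defect is ADDED to the shell width -/

section Defect

variable {Ω : Type*} [MeasurableSpace Ω]

omit [MeasurableSpace Ω] in
/-- if `|u − v| ≤ η` pointwise, the `(θ, ρ)`-shell of `u` lies in the shell `{θ(1−ρ) − η ≤ v < θ + η}` of `v`.
[folklore] -/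
theorem shell_subset_of_near {u v : Ω → ℝ} {η : ℝ} (h : ∀ x, |u x - v x| ≤ η) (θ ρ : ℝ) :
    {x | θ * (1 - ρ) ≤ u x ∧ u x < θ} ⊆ {x | θ * (1 - ρ) - η ≤ v x ∧ v x < θ + η} := by
  rintro x ⟨h1, h2⟩
  have hx := h x
  rw [abs_le] at hx
  exact ⟨by linarith [hx.2], by linarith [hx.1]⟩

/-- **THE DEFECT IS ADDITIVE.**  `|u − v| ≤ η` pointwise, `θ + η > 0`, and (M1) for the comparison classifier `v` at
threshold `θ + η` and relative width `(θρ + 2η)/(θ + η)` with constant `D` give for the `(θ, ρ)`-shell of `u` the mass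
bound `D·(θρ + 2η)/(θ + η) × mass` — i.e. `ρ` is replaced by `ρ + 2η/θ` up to the factor `θ/(θ + η)`; useless unless
`η ≲ θρ`. [folklore] -/
theorem shell_le_of_near (ν : Measure Ω) {u v : Ω → ℝ} {η θ ρ D : ℝ} (h : ∀ x, |u x - v x| ≤ η)
    (hθη : 0 < θ + η) (hv : SlotAntiConcentration ν v (θ + η) ((θ * ρ + 2 * η) / (θ + η)) D) :
    ν {x | θ * (1 - ρ) ≤ u x ∧ u x < θ} ≤ ENNReal.ofReal (D * ((θ * ρ + 2 * η) / (θ + η))) * ν univ := by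
  have hlev : (θ + η) * (1 - (θ * ρ + 2 * η) / (θ + η)) = θ * (1 - ρ) - η := by
    field_simp; ring
  unfold SlotAntiConcentration at hv
  rw [hlev] at hv
  exact (measure_mono (shell_subset_of_near h θ ρ)).trans hv

end Defect

/-! ## §3 Negative certificate: log-concave law, analytic NON-convex classifier, no (M1) -/

section Toy

/-- the density of the uniform law on `[−1,1]` is a log-concave weight (indicator of a convex window). [folklore] -/
theorem toyWeight_isLogConcave : IsLogConcaveWeight ((Icc (-1 : ℝ) 1).indicator fun _ => (1 : ℝ≥0∞)) :=
  isLogConcaveWeight_indicator_one (convex_Icc _ _)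

/-- the uniform law on `[−1,1]` is Lebesgue measure with that density. [folklore] -/
theorem toyLaw_eq : (volume : Measure ℝ).withDensity ((Icc (-1 : ℝ) 1).indicator fun _ => (1 : ℝ≥0∞)) =
    volume.restrict (Icc (-1 : ℝ) 1) := by
  rw [← withDensity_indicator_one measurableSet_Icc]
  rfl

/-- total mass of the toy law: `2`. [folklore] -/
theorem toy_univ : (volume.restrict (Icc (-1 : ℝ) 1)) univ = ENNReal.ofReal 2 := by
  rw [Measure.restrict_apply_univ, Real.volume_Icc]; norm_num

/-- (C-iii) for the toy, crudely: the classifier `1 − x²` is below half-threshold on `[3/4, 1]`, of mass `1/4`, so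
total mass `2 ≤ e^{log 8}·(mass below 1/2)`. [folklore] -/
theorem toy_halfMass : (volume.restrict (Icc (-1 : ℝ) 1)) univ ≤
    ENNReal.ofReal (Real.exp (Real.log 8)) *
      (volume.restrict (Icc (-1 : ℝ) 1)) {x : ℝ | 1 - x ^ 2 < 1 / 2} := by
  have hsub : Icc (3 / 4 : ℝ) 1 ⊆ {x : ℝ | 1 - x ^ 2 < 1 / 2} ∩ Icc (-1 : ℝ) 1 := by
    rintro x ⟨h1, h2⟩
    refine ⟨?_, ⟨by linarith, h2⟩⟩
    show 1 - x ^ 2 < 1 / 2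
    nlinarith
  have hmeas : MeasurableSet {x : ℝ | 1 - x ^ 2 < 1 / 2} :=
    measurableSet_lt ((measurable_const.sub (measurable_id.pow_const 2))) measurable_const
  rw [toy_univ, Real.exp_log (by norm_num), Measure.restrict_apply hmeas]
  calc ENNReal.ofReal 2 = ENNReal.ofReal 8 * ENNReal.ofReal (1 - 3 / 4) := by
        rw [← ENNReal.ofReal_mul (by norm_num)]; norm_num
    _ = ENNReal.ofReal 8 * volume (Icc (3 / 4 : ℝ) 1) := by rw [Real.volume_Icc]
    _ ≤ ENNReal.ofReal 8 * volume ({x : ℝ | 1 - x ^ 2 < 1 / 2} ∩ Icc (-1 : ℝ) 1) :=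
        mul_le_mul' le_rfl (measure_mono hsub)

/-- the `(1, ρ)`-shell of the classifier `1 − x²` is `[−√ρ, √ρ] ∖ {0}`. [folklore] -/
theorem toy_shell_eq {ρ : ℝ} (hρ : 0 ≤ ρ) :
    {x : ℝ | 1 * (1 - ρ) ≤ 1 - x ^ 2 ∧ 1 - x ^ 2 < 1} = Icc (-Real.sqrt ρ) (Real.sqrt ρ) \ {0} := by
  ext x
  simp only [mem_setOf_eq, Set.mem_sdiff, mem_Icc, mem_singleton_iff, one_mul]
  constructor
  · rintro ⟨h1, h2⟩
    have hsq : x ^ 2 ≤ ρ := by linarith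
    have habs : |x| ≤ Real.sqrt ρ := Real.abs_le_sqrt hsq
    refine ⟨abs_le.1 habs, fun hx => ?_⟩
    rw [hx] at h2; norm_num at h2
  · rintro ⟨⟨h1, h2⟩, hx⟩
    have habs : |x| ≤ Real.sqrt ρ := abs_le.2 ⟨h1, h2⟩
    have hsq : x ^ 2 ≤ ρ := by
      have h := pow_le_pow_left₀ (abs_nonneg x) habs 2
      rwa [sq_abs, Real.sq_sqrt hρ] at h
    have hpos : 0 < x ^ 2 := by positivity
    exact ⟨by linarith, by linarith⟩

/-- the shell mass of the toy: `vol{1 − ρ ≤ 1 − x² < 1} = 2√ρ` for `0 ≤ ρ ≤ 1`. [folklore] -/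
theorem toy_shell {ρ : ℝ} (hρ : 0 ≤ ρ) (hρ1 : ρ ≤ 1) :
    (volume.restrict (Icc (-1 : ℝ) 1)) {x : ℝ | 1 * (1 - ρ) ≤ 1 - x ^ 2 ∧ 1 - x ^ 2 < 1} =
      ENNReal.ofReal (2 * Real.sqrt ρ) := by
  have hs1 : Real.sqrt ρ ≤ 1 := by rw [← Real.sqrt_one]; exact Real.sqrt_le_sqrt hρ1
  have hs0 : 0 ≤ Real.sqrt ρ := Real.sqrt_nonneg ρ
  have hmeas : MeasurableSet (Icc (-Real.sqrt ρ) (Real.sqrt ρ) \ ({0} : Set ℝ)) :=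
    measurableSet_Icc.diff (measurableSet_singleton 0)
  have hsub : Icc (-Real.sqrt ρ) (Real.sqrt ρ) \ ({0} : Set ℝ) ⊆ Icc (-1 : ℝ) 1 :=
    fun x hx => ⟨by linarith [hx.1.1], by linarith [hx.1.2]⟩
  rw [toy_shell_eq hρ, Measure.restrict_apply hmeas, inter_eq_left.2 hsub,
    measure_sdiff_null Real.volume_singleton, Real.volume_Icc]
  congr 1; ring

/-- **CONVEXITY CANNOT BE WEAKENED TO SMOOTHNESS IN MEMBER (λ).**  Under the uniform law on `[−1,1]` (log-concave,
`toyWeight_isLogConcave` / `toyLaw_eq`; mass ratio (C-iii) with `e^P = 8`, `toy_halfMass`) the analytic NON-convex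
classifier `u(x) = 1 − x²` violates (M1) at its critical threshold `θ = 1`: for every `D` there is `ρ ∈ (0, 1/4]` with
`¬ SlotAntiConcentration (vol|[−1,1]) u 1 ρ D` (shell mass `2√ρ` against `2Dρ`). [folklore] -/
theorem not_slotAntiConcentration_concaveToy (D : ℝ) : ∃ ρ : ℝ, 0 < ρ ∧ ρ ≤ 1 / 4 ∧
    ¬ SlotAntiConcentration (volume.restrict (Icc (-1 : ℝ) 1)) (fun x : ℝ => 1 - x ^ 2) 1 ρ D := by
  set m : ℝ := max D 1 with hm_def
  have hm1 : 1 ≤ m := le_max_right _ _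
  have hm0 : 0 < m := by linarith
  have hDm : D ≤ m := le_max_left _ _
  set t : ℝ := 1 / (2 * m) with ht_def
  have ht0 : 0 < t := by positivity
  have ht1 : t ≤ 1 / 2 := by
    rw [ht_def]; exact one_div_le_one_div_of_le (by norm_num) (by linarith)
  refine ⟨t ^ 2, by positivity, by nlinarith, fun hM1 => ?_⟩
  unfold SlotAntiConcentration at hM1
  rw [toy_shell (by positivity) (by nlinarith), Real.sqrt_sq ht0.le, toy_univ] at hM1
  -- 2t ≤ (D t²)·2 ≤ (m t²)·2, i.e. 1 ≤ m t = 1/2: contradiction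
  have h2 : ENNReal.ofReal (2 * t) ≤ ENNReal.ofReal (m * t ^ 2 * 2) := by
    calc ENNReal.ofReal (2 * t) ≤ ENNReal.ofReal (D * t ^ 2) * ENNReal.ofReal 2 := hM1
      _ ≤ ENNReal.ofReal (m * t ^ 2) * ENNReal.ofReal 2 :=
          mul_le_mul' (ENNReal.ofReal_le_ofReal (by nlinarith)) le_rfl
      _ = ENNReal.ofReal (m * t ^ 2 * 2) := by rw [← ENNReal.ofReal_mul (by positivity)]
  have h3 : 2 * t ≤ m * t ^ 2 * 2 := (ENNReal.ofReal_le_ofReal_iff (by positivity)).1 h2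
  have h4 : m * t = 1 / 2 := by rw [ht_def]; field_simp
  nlinarith

end Toy

end Summit.QuantumFields.BalabanUV.T4Continuum.ShellMeasureLogConcaveSU2
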